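import Summits.Parity.GeneralizedHardyLittlewood.Theorems.LeeYangFibresRelativeDimOneMoebiusSplitTermBoundAux1
import Summits.Parity.GeneralizedHardyLittlewood.Theorems.LeeYangFibresAbsoluteUpgradeSlices
import Mathlib
import HarnessLib

/-!
# Route `LeeYangFibres`, crux `RelativeDimOne` (stmt-Parity-14113), line `single-moebius-split`,
# stub `stub_termBound` — auxiliary file 4: Abel summation of a monotone weight against the
# single-Möbius hybrid sums

In the reduction of term `j ≥ 1` to the atom `HybridOneMoebius`, the opened von Mangoldt factor
carries the weight `log(d/R_j)` on the Möbius variable `d = φ₀(m)`, monotone in `m`. This file removes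
it by Abel summation: if the atom bound `(β_∞ 𝔖 + Y)/(log Y)^A` holds for the system `Φ` on EVERY
convex body inside `[-Y, Y]`, then for a convex `K' ⊆ [-Y, Y]` and a monotone weight `0 ≤ w ≤ G`,
`|∑_{m ∈ [-Y,Y] ∩ K'} μ(φ₀(m)) w(m) ∏_i Λ(φ_i(m))| ≤ 2G · (2Y 𝔖 + Y)/(log Y)^A`
(`termBound_aux_abel_atom`, registered sub-goal): the partial sums over `m ≤ t` are atom sums over
the convex bodies `K' ∩ {x₀ ≤ t}`, and `β_∞ ≤ 2Y` (`archFactor_le_two_mul`).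

* `abs_sum_range_mul_le_of_monotone` — Abel summation: `|∑_{i<n} f(i) g(i)| ≤ 2GB` for monotone
  `0 ≤ f ≤ G` and partial sums of `g` bounded by `B`;
* `sum_Icc_eq_sum_range_shift` — `[-Y, Y] ⊆ ℤ` reindexed by `range (2Y+1)`.
-/

noncomputable section

open scoped BigOperators Classical
open Finset Literature.NumberTheory.Sieve
open Summit.Parity.GeneralizedHardyLittlewood.Theorems.AbsoluteUpgrade (archFactor_le_two_mul)

namespace Summit.Parity.GeneralizedHardyLittlewood.Cruxes.RelativeDimOne.SingleMoebiusSplit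

/-! ### Abel summation -/

/-- **Abel summation against a monotone bounded weight.** If `f` is monotone or antitone with
`0 ≤ f ≤ G`, and all partial sums `∑_{j<i} g(j)` (`i ≤ n`) are at most `B` in absolute value, then
`|∑_{i<n} f(i) g(i)| ≤ 2GB` (summation by parts: the boundary term is `≤ GB` and the variation term
`≤ B · |f(n−1) − f(0)| ≤ GB`). -/
theorem abs_sum_range_mul_le_of_monotone (f g : ℕ → ℝ) (n : ℕ) {G B : ℝ}
    (hmono : Monotone f ∨ Antitone f) (hf0 : ∀ i, 0 ≤ f i) (hfG : ∀ i, f i ≤ G)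
    (hB : ∀ i ≤ n, |∑ j ∈ Finset.range i, g j| ≤ B) :
    |∑ i ∈ Finset.range n, f i * g i| ≤ 2 * G * B := by
  have hG0 : 0 ≤ G := (hf0 0).trans (hfG 0)
  have hB0 : 0 ≤ B := (abs_nonneg _).trans (hB 0 (Nat.zero_le n))
  have habs : ∀ i i', |f i - f i'| ≤ G := fun i i' => by
    rw [abs_le]; constructor <;> linarith [hf0 i, hf0 i', hfG i, hfG i']
  have hparts := Finset.sum_range_by_parts f g n
  simp only [smul_eq_mul] at hparts
  rw [hparts]
  -- the variation term
  have hvar : |∑ i ∈ Finset.range (n - 1), (f (i + 1) - f i) * ∑ j ∈ Finset.range (i + 1), g j| ≤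
      G * B := by
    calc |∑ i ∈ Finset.range (n - 1), (f (i + 1) - f i) * ∑ j ∈ Finset.range (i + 1), g j|
        ≤ ∑ i ∈ Finset.range (n - 1), |(f (i + 1) - f i) * ∑ j ∈ Finset.range (i + 1), g j| :=
          Finset.abs_sum_le_sum_abs _ _
      _ ≤ ∑ i ∈ Finset.range (n - 1), |f (i + 1) - f i| * B := by
          refine Finset.sum_le_sum fun i hi => ?_
          rw [abs_mul]
          refine mul_le_mul_of_nonneg_left (hB (i + 1) ?_) (abs_nonneg _)
          have := Finset.mem_range.mp hi
          omega
      _ = (∑ i ∈ Finset.range (n - 1), |f (i + 1) - f i|) * B := (Finset.sum_mul _ _ _).symm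
      _ ≤ G * B := by
          refine mul_le_mul_of_nonneg_right ?_ hB0
          rcases hmono with hm | hm
          · have : ∀ i ∈ Finset.range (n - 1), |f (i + 1) - f i| = f (i + 1) - f i :=
              fun i _ => abs_of_nonneg (sub_nonneg.mpr (hm (Nat.le_succ i)))
            rw [Finset.sum_congr rfl this, Finset.sum_range_sub]
            exact (le_abs_self _).trans (habs _ _)
          · have : ∀ i ∈ Finset.range (n - 1), |f (i + 1) - f i| = f i - f (i + 1) :=
              fun i _ => by rw [abs_sub_comm]; exact abs_of_nonneg (sub_nonneg.mpr (hm (Nat.le_succ i)))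
            rw [Finset.sum_congr rfl this, Finset.sum_range_sub']
            exact (le_abs_self _).trans (habs _ _)
  -- the boundary term
  have hbd : |f (n - 1) * ∑ i ∈ Finset.range n, g i| ≤ G * B := by
    rw [abs_mul, abs_of_nonneg (hf0 _)]
    exact mul_le_mul (hfG _) (hB n le_rfl) (abs_nonneg _) hG0
  calc _ ≤ |f (n - 1) * ∑ i ∈ Finset.range n, g i| +
        |∑ i ∈ Finset.range (n - 1), (f (i + 1) - f i) * ∑ j ∈ Finset.range (i + 1), g j| :=
        abs_sub _ _
    _ ≤ G * B + G * B := add_le_add hbd hvar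
    _ = 2 * G * B := by ring

/-! ### The integer interval `[-Y, Y]` -/

/-- `∑_{m ∈ [-Y, Y]} F(m) = ∑_{i < 2Y+1} F(i − Y)`. -/
theorem sum_Icc_eq_sum_range_shift (Y : ℕ) (F : ℤ → ℝ) :
    ∑ m ∈ Finset.Icc (-(Y : ℤ)) Y, F m = ∑ i ∈ Finset.range (2 * Y + 1), F ((i : ℤ) - Y) := by
  refine Finset.sum_nbij' (fun m => (m + Y).toNat) (fun i => (i : ℤ) - Y) ?_ ?_ ?_ ?_ ?_
  · intro m hm; simp only [Finset.mem_Icc, Finset.mem_range] at hm ⊢; omega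
  · intro i hi; simp only [Finset.mem_Icc, Finset.mem_range] at hi ⊢; omega
  · intro m hm; simp only [Finset.mem_Icc] at hm; omega
  · intro i _; simp
  · intro m hm; simp only [Finset.mem_Icc] at hm; congr 1; omega

/-- Partial sums along `[-Y, Y]`: for `i ≤ 2Y + 1`,
`∑_{j < i} F(j − Y) = ∑_{m ∈ [-Y, Y], m ≤ i − 1 − Y} F(m)`. -/
theorem sum_range_shift_eq_sum_Icc_filter (Y : ℕ) (F : ℤ → ℝ) {i : ℕ} (hi : i ≤ 2 * Y + 1) :
    ∑ j ∈ Finset.range i, F ((j : ℤ) - Y) =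
      ∑ m ∈ (Finset.Icc (-(Y : ℤ)) Y).filter (fun m : ℤ => (m : ℝ) ≤ (((i : ℤ) - 1 - Y : ℤ) : ℝ)),
        F m := by
  refine Finset.sum_nbij' (fun j => (j : ℤ) - Y) (fun m => (m + Y).toNat) ?_ ?_ ?_ ?_ ?_
  · intro j hj
    simp only [Finset.mem_range] at hj
    simp only [Finset.mem_filter, Finset.mem_Icc, Int.cast_le]
    omega
  · intro m hm
    simp only [Finset.mem_filter, Finset.mem_Icc, Int.cast_le] at hm
    simp only [Finset.mem_range]
    omega
  · intro j _; simp
  · intro m hm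
    simp only [Finset.mem_filter, Finset.mem_Icc] at hm
    omega
  · intro j _; rfl

/-! ### Convex bodies cut by `{x₀ ≤ t}` -/

/-- The half-space `{x : x₀ ≤ t}` of `ℝ¹` is convex. -/
theorem convex_setOf_apply_le (t : ℝ) : Convex ℝ {x : Fin 1 → ℝ | x 0 ≤ t} :=
  convex_halfSpace_le (IsLinearMap.mk (fun _ _ => rfl) (fun _ _ => rfl)) t


/-! ### Abel summation against the atom -/

/-- **Abel summation against the single-Möbius hybrid atom** (registered sub-goal for
`stub_termBound`). Let `Φ = (φ₀; φ₁, …, φ_s)` be a system for which the atom bound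
`|∑_{n ∈ K'' ∩ ℤ} μ(φ₀(n)) ∏_i Λ(φ_i(n))| ≤ (β_∞(Φ'; K'') 𝔖(Φ') + Y)/(log Y)^A` holds for EVERY convex
`K'' ⊆ [-Y, Y]` (`Φ' = (φ₁, …, φ_s)`, `𝔖(Φ') ≥ 0`), let `K' ⊆ [-Y, Y]` be convex and let `w` be a
monotone (or antitone) weight with `0 ≤ w ≤ G`. Then
`|∑_{m ∈ [-Y, Y] ∩ K'} μ(φ₀(m)) w(m) ∏_i Λ(φ_i(m))| ≤ 2G (2Y 𝔖(Φ') + Y)/(log Y)^A`: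
the partial sums `m ≤ t` are atom sums over the convex bodies `K' ∩ {x₀ ≤ t}` (each bounded by
`(2Y𝔖 + Y)/(log Y)^A` as `β_∞ ≤ 2Y`), and Abel summation costs the factor `2G`. -/
theorem termBound_aux_abel_atom : ∀ (s Y : ℕ) (A G : ℝ) (Φ : Fin (s + 1) → AffLinForm 1)
    (K' : Set (Fin 1 → ℝ)) (w : ℤ → ℝ),
    Convex ℝ K' → K' ⊆ realBox 1 Y → 0 ≤ singularProduct (fun i : Fin s => Φ i.succ) →
    (Monotone w ∨ Antitone w) → (∀ m, 0 ≤ w m) → (∀ m, w m ≤ G) →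
    (∀ K'' : Set (Fin 1 → ℝ), Convex ℝ K'' → K'' ⊆ realBox 1 Y →
      |∑ n ∈ (latticeBox 1 Y).filter (fun n => realPoint n ∈ K''),
          (ArithmeticFunction.moebius ((Φ 0).eval n).toNat : ℝ) *
            ∏ i : Fin s, intVonMangoldt ((Φ i.succ).eval n)| ≤
        (archFactor (fun i : Fin s => Φ i.succ) K'' * singularProduct (fun i : Fin s => Φ i.succ)
          + Y) / Real.log Y ^ A) →
    |∑ m ∈ Finset.Icc (-(Y : ℤ)) Y, (if (fun _ : Fin 1 => (m : ℝ)) ∈ K' then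
        (ArithmeticFunction.moebius ((Φ 0).eval (fun _ => m)).toNat : ℝ) *
          ∏ i : Fin s, intVonMangoldt ((Φ i.succ).eval (fun _ => m)) else 0) * w m| ≤
      2 * G * ((2 * Y * singularProduct (fun i : Fin s => Φ i.succ) + Y) / Real.log Y ^ A) := by
  intro s Y A G Φ K' w hK' hK'Y h𝔖 hmono hw0 hwG hatom
  -- name the cut-off summand `F` and the bound `B`
  obtain ⟨F, hF⟩ : ∃ F : ℤ → ℝ, ∀ m, F m = (if (fun _ : Fin 1 => (m : ℝ)) ∈ K' then
      (ArithmeticFunction.moebius ((Φ 0).eval (fun _ => m)).toNat : ℝ) *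
        ∏ i : Fin s, intVonMangoldt ((Φ i.succ).eval (fun _ => m)) else 0) := ⟨_, fun m => rfl⟩
  obtain ⟨B, hB⟩ : ∃ B : ℝ,
      B = (2 * Y * singularProduct (fun i : Fin s => Φ i.succ) + Y) / Real.log Y ^ A := ⟨_, rfl⟩
  have hlog0 : 0 ≤ Real.log Y ^ A := by
    refine Real.rpow_nonneg ?_ A
    rcases Nat.eq_zero_or_pos Y with hY | hY
    · rw [hY, Nat.cast_zero, Real.log_zero]
    · exact Real.log_nonneg (by exact_mod_cast hY)
  -- Step 1: every partial sum over `m ≤ t` is an atom sum over `K' ∩ {x₀ ≤ t}`, bounded by `B`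
  have hpartial : ∀ t : ℝ,
      |∑ m ∈ (Finset.Icc (-(Y : ℤ)) Y).filter (fun m : ℤ => (m : ℝ) ≤ t), F m| ≤ B := by
    intro t
    have hc : Convex ℝ (K' ∩ {x | x 0 ≤ t}) := hK'.inter (convex_setOf_apply_le t)
    have hsubY : K' ∩ {x | x 0 ≤ t} ⊆ realBox 1 Y := fun x hx => hK'Y hx.1
    have hat := hatom (K' ∩ {x | x 0 ≤ t}) hc hsubY
    rw [sum_filter_latticeBox_dimOne, Finset.sum_filter] at hat
    have key : ∀ S T : ℝ, |S| ≤ T →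
        S = ∑ m ∈ (Finset.Icc (-(Y : ℤ)) Y).filter (fun m : ℤ => (m : ℝ) ≤ t), F m → T ≤ B →
        |∑ m ∈ (Finset.Icc (-(Y : ℤ)) Y).filter (fun m : ℤ => (m : ℝ) ≤ t), F m| ≤ B := by
      rintro S T h rfl hT; exact h.trans hT
    refine key _ _ hat ?_ ?_
    · rw [Finset.sum_filter]
      refine Finset.sum_congr rfl fun m _ => ?_
      have hmem : realPoint (fun _ : Fin 1 => m) ∈ K' ∩ {x | x 0 ≤ t} ↔
          ((fun _ : Fin 1 => (m : ℝ)) ∈ K' ∧ (m : ℝ) ≤ t) := Iff.rfl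
      rw [hF m]
      by_cases h1 : (m : ℝ) ≤ t
      · by_cases h2 : (fun _ : Fin 1 => (m : ℝ)) ∈ K'
        · rw [if_pos (hmem.mpr ⟨h2, h1⟩), if_pos h1, if_pos h2]
        · rw [if_neg (fun h => h2 (hmem.mp h).1), if_pos h1, if_neg h2]
      · rw [if_neg (fun h => h1 (hmem.mp h).2), if_neg h1]
    · rw [hB]
      refine div_le_div_of_nonneg_right ?_ hlog0
      have hβ : archFactor (fun i : Fin s => Φ i.succ) (K' ∩ {x | x 0 ≤ t}) ≤ 2 * (Y : ℝ) :=
        archFactor_le_two_mul _ hsubY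
      nlinarith
  -- Step 2: reindex by `range (2Y + 1)` and apply Abel summation
  have hB0 : ∀ i ≤ 2 * Y + 1, |∑ j ∈ Finset.range i, F ((j : ℤ) - Y)| ≤ B := by
    intro i hi
    rw [sum_range_shift_eq_sum_Icc_filter Y F hi]
    exact hpartial _
  have hmono' : Monotone (fun i : ℕ => w ((i : ℤ) - Y)) ∨ Antitone (fun i : ℕ => w ((i : ℤ) - Y)) := by
    rcases hmono with hm | hm
    · exact Or.inl fun i i' hii' => hm (by simpa using hii')
    · exact Or.inr fun i i' hii' => hm (by simpa using hii')
  have habel := abs_sum_range_mul_le_of_monotone (fun i : ℕ => w ((i : ℤ) - Y))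
    (fun j => F ((j : ℤ) - Y)) (2 * Y + 1) hmono' (fun i => hw0 _) (fun i => hwG _) hB0
  have hfinal : ∑ m ∈ Finset.Icc (-(Y : ℤ)) Y, (if (fun _ : Fin 1 => (m : ℝ)) ∈ K' then
      (ArithmeticFunction.moebius ((Φ 0).eval (fun _ => m)).toNat : ℝ) *
        ∏ i : Fin s, intVonMangoldt ((Φ i.succ).eval (fun _ => m)) else 0) * w m =
      ∑ i ∈ Finset.range (2 * Y + 1), w ((i : ℤ) - Y) * F ((i : ℤ) - Y) := by
    rw [sum_Icc_eq_sum_range_shift]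
    exact Finset.sum_congr rfl fun i _ => by rw [hF, mul_comm]
  rw [hfinal]
  rw [hB] at habel
  exact habel

end Summit.Parity.GeneralizedHardyLittlewood.Cruxes.RelativeDimOne.SingleMoebiusSplit
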